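import Summits.Ventures.LatticeQCDFlow.Scoring.OnePlaquetteSU3
import Summits.Ventures.LatticeQCDFlow.Exactness.SpectralKernelJacobianWeylShapeSU
import Summits.Ventures.LatticeQCDFlow.Exactness.TorusCircleChart
import Literature.MathematicalPhysics.QuantumFieldTheory.CircleHaarAngle
import Literature.MathematicalPhysics.QuantumLattice.GaugeGroupsProofs
import HarnessLib

/-!
# Haar measure on the maximal torus `SΔ(3)` of `SU(3)` in eigen-angles; the Weyl density of a diagonal element

HONEST FRAMING: exact (Metropolis-corrected) sampling algorithms for lattice gauge theory;
figures of merit are autocorrelation/cost numbers at stated couplings and volumes; no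
continuum-physics claim.

Venture `LatticeQCDFlow` (cell pub-lqcd), sub-topic `Scoring`; FANOUT row 5 (`s0-sun-a`), GEN-16.
NEW WORK of the cell (placement rule): the UNCONDITIONAL torus half of the bridge between theory-2's
Haar-measure `SU(3)` objects and row 5's Weyl-torus one-plaquette law (`OnePlaquetteSU3*.lean`,
coordinates `θ₁, θ₂`, `θ₃ = −θ₁−θ₂`, density `weylSU3`).  Part 2 (`OnePlaquetteSU3HaarBridge.lean`)
adds Weyl's integral formula for `SU(3)` — the tree's NAMED FACT
`Literature.RepresentationTheory.CompactGroups.weylIntegralFormula_specialUnitary (Fin 3)`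
(Bröcker–tom Dieck IV (1.11); proved in the tree for `Fin 2`, `Exactness/WeylIntegralFormulaSU2.lean`;
the `U(n)` discharge is in progress in `Literature/RepresentationTheory/CompactGroups/WeylIntegration*`).

* §1 `norm_cexp_mul_I_sub_sq` (`|e^{ia} − e^{ib}|² = 2 − 2cos(a−b)`), `prod_prod_erase_norm_sub_fin_three`,
  **`vandermonde_su3Diag_eq_weylSU3`** — for `t = diag(e^{iθ₁}, e^{iθ₂}, e^{−i(θ₁+θ₂)})` the Weyl
  factor of the named fact, `∏_i ∏_{j≠i} |t_ii − t_jj|`, IS GEN-6's `weylSU3 θ₁ θ₂`; `trace_re_su3Diag`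
  (`Re tr t = reTrSU3 θ₁ θ₂`); periodicity of the torus matrix in each angle;
* §2 `integral2_eq_setIntegral_pi` (iterated integral over `[a,b]²` = cube integral on `Fin 2 → ℝ`),
  `integral2_periodic_shift` (`[−π,π]² → [0,2π]²` for doubly periodic integrands);
* §3 **`integral_haar_su3Torus_eq_integral2`** — for continuous `K` on matrices,
  `∫_{SΔ(3)} K(t) dHaar_{SΔ(3)}(t) = (2π)⁻² ∫_{−π}^{π}∫_{−π}^{π} K(diag(e^{iθ₁}, e^{iθ₂}, e^{−i(θ₁+θ₂)})) dθ₂ dθ₁`: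
  the chart `(z, w) ↦ diag(z, w, (zw)⁻¹)` from `U(1)²` is a continuous surjective homomorphism onto
  the tree's `specialDiagonalTorus (Fin 3)` (`Literature/LinearAlgebra/Matrix/UnitaryGroupMaximalTorus`),
  hence presents its Haar probability (row 10's `TorusCircleChart.map_eq_haarProbability_of_mul_of_surjective`,
  uniqueness of Haar measure), and `Haar_{U(1)}` is `dθ/2π` (`CircleHaarAngle.integral_pi_haarProbability_circle`).

Nothing is cited as a fact; no `def` (the chart is a term inside the proof of §3).
-/

noncomputable section

open Real MeasureTheory Finset
open Literature.MathematicalPhysics.QuantumFieldTheory (haarProbability)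
open Literature.MathematicalPhysics.QuantumFieldTheory.CircleHaar (integral_pi_haarProbability_circle)
open Literature.MathematicalPhysics.QuantumLattice
open Literature.LinearAlgebra.Matrix
open Summit.Ventures.LatticeQCDFlow.Exactness

namespace Summit.Ventures.LatticeQCDFlow.Scoring

/-! ### 1. Elementary identities: chord lengths, the Vandermonde weight of a diagonal `SU(3)` matrix -/

/-- `|e^{ia} − e^{ib}|² = 2 − 2 cos(a − b)`. -/
theorem norm_cexp_mul_I_sub_sq (a b : ℝ) :
    ‖Complex.exp ((a : ℂ) * Complex.I) - Complex.exp ((b : ℂ) * Complex.I)‖ ^ 2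
      = 2 - 2 * Real.cos (a - b) := by
  rw [Complex.sq_norm, Complex.normSq_apply]
  simp only [Complex.sub_re, Complex.sub_im, Complex.exp_ofReal_mul_I_re, Complex.exp_ofReal_mul_I_im]
  rw [Real.cos_sub]
  linear_combination (Real.sin_sq_add_cos_sq a) + (Real.sin_sq_add_cos_sq b)

/-- `(e^{ia} e^{ib})⁻¹ = e^{−i(a+b)}`. -/
theorem cexp_mul_cexp_inv (a b : ℝ) :
    (Complex.exp ((a : ℂ) * Complex.I) * Complex.exp ((b : ℂ) * Complex.I))⁻¹
      = Complex.exp (((-(a + b) : ℝ) : ℂ) * Complex.I) := by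
  rw [← Complex.exp_add, ← Complex.exp_neg]
  congr 1
  push_cast
  ring

/-- The Vandermonde double product on `Fin 3`: `∏_i ∏_{j ≠ i} |d_i − d_j| = ∏_{i<j} |d_i − d_j|²`. -/
theorem prod_prod_erase_norm_sub_fin_three (d : Fin 3 → ℂ) :
    ∏ i, ∏ j ∈ univ.erase i, ‖d i - d j‖
      = ‖d 0 - d 1‖ ^ 2 * ‖d 0 - d 2‖ ^ 2 * ‖d 1 - d 2‖ ^ 2 := by
  have e0 : (univ : Finset (Fin 3)).erase 0 = {1, 2} := by decide
  have e1 : (univ : Finset (Fin 3)).erase 1 = {0, 2} := by decide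
  have e2 : (univ : Finset (Fin 3)).erase 2 = {0, 1} := by decide
  rw [Fin.prod_univ_three, e0, e1, e2, Finset.prod_pair (by decide), Finset.prod_pair (by decide),
    Finset.prod_pair (by decide), norm_sub_rev (d 1) (d 0), norm_sub_rev (d 2) (d 0),
    norm_sub_rev (d 2) (d 1)]
  ring

/-- **The Weyl density of a diagonal `SU(3)` element in eigen-angles**: for
`d = (e^{iθ₁}, e^{iθ₂}, e^{−i(θ₁+θ₂)})`, `∏_i ∏_{j ≠ i} |d_i − d_j| = |Δ|²(θ₁, θ₂) = weylSU3 θ₁ θ₂`. -/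
theorem vandermonde_su3Diag_eq_weylSU3 (θ₁ θ₂ : ℝ) :
    ∏ i, ∏ j ∈ univ.erase i,
        ‖(![Complex.exp ((θ₁ : ℂ) * Complex.I), Complex.exp ((θ₂ : ℂ) * Complex.I),
            Complex.exp (((-(θ₁ + θ₂) : ℝ) : ℂ) * Complex.I)] : Fin 3 → ℂ) i
          - (![Complex.exp ((θ₁ : ℂ) * Complex.I), Complex.exp ((θ₂ : ℂ) * Complex.I),
            Complex.exp (((-(θ₁ + θ₂) : ℝ) : ℂ) * Complex.I)] : Fin 3 → ℂ) j‖
      = weylSU3 θ₁ θ₂ := by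
  rw [prod_prod_erase_norm_sub_fin_three]
  simp only [Matrix.cons_val_zero, Matrix.cons_val_one, Matrix.cons_val]
  rw [norm_cexp_mul_I_sub_sq, norm_cexp_mul_I_sub_sq, norm_cexp_mul_I_sub_sq, weylSU3]
  have h2 : Real.cos (θ₁ - -(θ₁ + θ₂)) = Real.cos (2 * θ₁ + θ₂) := by congr 1; ring
  have h3 : Real.cos (θ₂ - -(θ₁ + θ₂)) = Real.cos (θ₁ + 2 * θ₂) := by congr 1; ring
  rw [h2, h3]

/-- The diagonal `SU(3)` matrix `diag(e^{iθ₁}, e^{iθ₂}, e^{−i(θ₁+θ₂)})` has `Re tr = reTrSU3 θ₁ θ₂`. -/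
theorem trace_re_su3Diag (θ₁ θ₂ : ℝ) :
    (Matrix.diagonal (![Complex.exp ((θ₁ : ℂ) * Complex.I), Complex.exp ((θ₂ : ℂ) * Complex.I),
        Complex.exp (((-(θ₁ + θ₂) : ℝ) : ℂ) * Complex.I)] : Fin 3 → ℂ)).trace.re = reTrSU3 θ₁ θ₂ := by
  rw [Matrix.trace_diagonal, Fin.sum_univ_three]
  simp only [Matrix.cons_val_zero, Matrix.cons_val_one, Matrix.cons_val, Complex.add_re,
    Complex.exp_ofReal_mul_I_re, reTrSU3, Real.cos_neg]

/-! ### 2. Iterated integrals over a square as cube integrals; periodic shifts -/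

/-- The iterated integral of a jointly continuous function over `[a,b]²` is its integral over the cube
`(a,b]²` of `Fin 2 → ℝ` (coordinates `θ 0 = θ₁`, `θ 1 = θ₂`). -/
theorem integral2_eq_setIntegral_pi {E : Type*} [NormedAddCommGroup E] [NormedSpace ℝ E]
    {a b : ℝ} (hab : a ≤ b) {g : ℝ → ℝ → E} (hg : Continuous fun p : ℝ × ℝ => g p.1 p.2) :
    (∫ θ₁ in a..b, ∫ θ₂ in a..b, g θ₁ θ₂)
      = ∫ θ in Set.pi Set.univ (fun _ : Fin 2 => Set.Ioc a b), g (θ 0) (θ 1) := by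
  haveI : IsFiniteMeasure ((volume : Measure ℝ).restrict (Set.Ioc a b)) :=
    isFiniteMeasure_restrict.mpr (by rw [Real.volume_Ioc]; exact ENNReal.ofReal_ne_top)
  have hpres := measurePreserving_finTwoArrow ((volume : Measure ℝ).restrict (Set.Ioc a b))
  have hG : (fun θ : Fin 2 → ℝ => g (θ 0) (θ 1))
      = fun θ => (fun p : ℝ × ℝ => g p.1 p.2) (MeasurableEquiv.finTwoArrow (α := ℝ) θ) := by
    funext θ
    simp [MeasurableEquiv.finTwoArrow]
  rw [show (volume : Measure (Fin 2 → ℝ)).restrict (Set.pi Set.univ fun _ => Set.Ioc a b)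
      = Measure.pi fun _ : Fin 2 => (volume : Measure ℝ).restrict (Set.Ioc a b) by
    rw [volume_pi, Measure.restrict_pi_pi], hG, hpres.integral_comp' (fun p : ℝ × ℝ => g p.1 p.2)]
  have hint : Integrable (fun p : ℝ × ℝ => g p.1 p.2)
      (((volume : Measure ℝ).restrict (Set.Ioc a b)).prod ((volume : Measure ℝ).restrict (Set.Ioc a b))) := by
    rw [Measure.prod_restrict]
    exact ((hg.continuousOn.integrableOn_compact (isCompact_Icc.prod isCompact_Icc)).mono_set
      (Set.prod_mono Set.Ioc_subset_Icc_self Set.Ioc_subset_Icc_self) :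
        IntegrableOn (fun p : ℝ × ℝ => g p.1 p.2) (Set.Ioc a b ×ˢ Set.Ioc a b) volume)
  rw [integral_prod _ hint, ← intervalIntegral.integral_of_le hab]
  exact intervalIntegral.integral_congr fun θ₁ _ => intervalIntegral.integral_of_le hab

/-- Shifting a doubly `2π`-periodic jointly continuous integrand from `[−π,π]²` to `[0,2π]²`. -/
theorem integral2_periodic_shift {P : ℝ → ℝ → ℝ}
    (h1 : ∀ θ₂, Function.Periodic (fun θ₁ => P θ₁ θ₂) (2 * π))
    (h2 : ∀ θ₁, Function.Periodic (P θ₁) (2 * π)) :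
    (∫ θ₁ in (-π)..π, ∫ θ₂ in (-π)..π, P θ₁ θ₂)
      = ∫ θ₁ in (0 : ℝ)..2 * π, ∫ θ₂ in (0 : ℝ)..2 * π, P θ₁ θ₂ := by
  have hin : ∀ θ₁, (∫ θ₂ in (-π)..π, P θ₁ θ₂) = ∫ θ₂ in (0 : ℝ)..2 * π, P θ₁ θ₂ := by
    intro θ₁
    have h := (h2 θ₁).intervalIntegral_add_eq (-π) 0
    simp only [zero_add, show -π + 2 * π = π by ring] at h
    exact h
  simp_rw [hin]
  have hper : Function.Periodic (fun θ₁ => ∫ θ₂ in (0 : ℝ)..2 * π, P θ₁ θ₂) (2 * π) := by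
    intro θ₁
    simp only
    exact intervalIntegral.integral_congr fun θ₂ _ => h1 θ₂ θ₁
  have h := hper.intervalIntegral_add_eq (-π) 0
  simp only [zero_add, show -π + 2 * π = π by ring] at h
  exact h

/-! ### 3. Haar measure on the maximal torus `SΔ(3)` in eigen-angles -/

/-- **Integrals over the Haar probability of the diagonal torus `SΔ(3)` of `SU(3)` in eigen-angles**:
for a continuous `K` on matrices,
`∫_{SΔ(3)} K(t) dt = (2π)⁻² ∫_{−π}^{π}∫_{−π}^{π} K(diag(e^{iθ₁}, e^{iθ₂}, e^{−i(θ₁+θ₂)})) dθ₂ dθ₁`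
(the two free eigen-phases present `Haar_{SΔ(3)}`: the chart `(z, w) ↦ diag(z, w, (zw)⁻¹)` from
`U(1)²` is a continuous surjective homomorphism, so it pushes `Haar_{U(1)} ⊗ Haar_{U(1)}` to
`Haar_{SΔ(3)}` by uniqueness — `TorusCircleChart.map_eq_haarProbability_of_mul_of_surjective` — and
`Haar_{U(1)}` is `dθ/2π`, `CircleHaarAngle`). -/
theorem integral_haar_su3Torus_eq_integral2 (K : Matrix (Fin 3) (Fin 3) ℂ → ℝ) (hK : Continuous K) :
    ∫ t, K (((t : specialDiagonalTorus (Fin 3)) : Matrix.specialUnitaryGroup (Fin 3) ℂ) :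
        Matrix (Fin 3) (Fin 3) ℂ) ∂(haarProbability (specialDiagonalTorus (Fin 3)))
      = 1 / (2 * π) ^ 2 * ∫ θ₁ in (-π)..π, ∫ θ₂ in (-π)..π,
          K (Matrix.diagonal ![Complex.exp ((θ₁ : ℂ) * Complex.I), Complex.exp ((θ₂ : ℂ) * Complex.I),
            Complex.exp (((-(θ₁ + θ₂) : ℝ) : ℂ) * Complex.I)]) := by
  -- the chart `(z 0, z 1) ↦ diag(z 0, z 1, (z 0 z 1)⁻¹)`
  have hmem : ∀ z : Fin 2 → Circle,
      Matrix.diagonal (![((z 0 : Circle) : ℂ), ((z 1 : Circle) : ℂ), (((z 0 * z 1)⁻¹ : Circle) : ℂ)] : Fin 3 → ℂ)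
        ∈ Matrix.specialUnitaryGroup (Fin 3) ℂ := by
    intro z
    refine (diagonal_mem_specialUnitaryGroup_iff _).mpr ⟨fun i => ?_, ?_⟩
    · fin_cases i <;> simp only [Matrix.cons_val_zero, Matrix.cons_val_one, Matrix.cons_val, Fin.isValue,
        Fin.reduceFinMk, Circle.norm_coe]
    · rw [Fin.prod_univ_three]
      simp only [Matrix.cons_val_zero, Matrix.cons_val_one, Matrix.cons_val, Circle.coe_inv, Circle.coe_mul]
      have h0 : ((z 0 : Circle) : ℂ) ≠ 0 := Circle.coe_ne_zero _
      have h1 : ((z 1 : Circle) : ℂ) ≠ 0 := Circle.coe_ne_zero _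
      field_simp
  let ch : (Fin 2 → Circle) → specialDiagonalTorus (Fin 3) := fun z =>
    ⟨⟨Matrix.diagonal (![((z 0 : Circle) : ℂ), ((z 1 : Circle) : ℂ), (((z 0 * z 1)⁻¹ : Circle) : ℂ)] : Fin 3 → ℂ),
      hmem z⟩, ⟨_, rfl⟩⟩
  have hch_coe : ∀ z, (((ch z : specialDiagonalTorus (Fin 3)) : Matrix.specialUnitaryGroup (Fin 3) ℂ) :
      Matrix (Fin 3) (Fin 3) ℂ)
        = Matrix.diagonal (![((z 0 : Circle) : ℂ), ((z 1 : Circle) : ℂ), (((z 0 * z 1)⁻¹ : Circle) : ℂ)]) :=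
    fun z => rfl
  have hvec : Continuous fun z : Fin 2 → Circle =>
      (![((z 0 : Circle) : ℂ), ((z 1 : Circle) : ℂ), (((z 0 * z 1)⁻¹ : Circle) : ℂ)] : Fin 3 → ℂ) := by
    refine continuous_pi fun i => ?_
    fin_cases i
    · show Continuous fun a : Fin 2 → Circle => ((a 0 : Circle) : ℂ)
      exact continuous_subtype_val.comp (continuous_apply 0)
    · show Continuous fun a : Fin 2 → Circle => ((a 1 : Circle) : ℂ)
      exact continuous_subtype_val.comp (continuous_apply 1)
    · show Continuous fun a : Fin 2 → Circle => (((a 0 * a 1)⁻¹ : Circle) : ℂ)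
      exact continuous_subtype_val.comp (((continuous_apply 0).mul (continuous_apply 1)).inv)
  have hch_cont : Continuous ch :=
    continuous_induced_rng.2 (continuous_induced_rng.2 hvec.matrix_diagonal)
  have hch_mul : ∀ z w, ch (z * w) = ch z * ch w := by
    intro z w
    apply Subtype.ext
    apply Subtype.ext
    change Matrix.diagonal _ = Matrix.diagonal _ * Matrix.diagonal _
    rw [Matrix.diagonal_mul_diagonal]
    congr 1
    funext i
    fin_cases i
    all_goals simp only [Pi.mul_apply, Matrix.cons_val_zero, Matrix.cons_val_one, Matrix.cons_val,
      Fin.isValue, Fin.reduceFinMk, Circle.coe_mul, Circle.coe_inv, mul_inv]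
    ring
  have hch_surj : Function.Surjective ch := by
    intro t
    obtain ⟨d, hd⟩ := t.2
    obtain ⟨hnorm, hprod⟩ := norm_eq_one_and_prod_eq_one_of_mem_specialDiagonalTorus hd
    have hmk : ∀ i, d i ∈ Submonoid.unitSphere ℂ := fun i => by
      simpa [Submonoid.unitSphere, mem_sphere_iff_norm] using hnorm i
    refine ⟨![⟨d 0, hmk 0⟩, ⟨d 1, hmk 1⟩], ?_⟩
    apply Subtype.ext
    apply Subtype.ext
    rw [hch_coe, hd]
    congr 1
    rw [Fin.prod_univ_three] at hprod
    have h0 : d 0 ≠ 0 := fun h => by simpa [h] using hnorm 0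
    have h1 : d 1 ≠ 0 := fun h => by simpa [h] using hnorm 1
    have h2 : d 2 = (d 0 * d 1)⁻¹ := eq_inv_of_mul_eq_one_right hprod
    funext i
    fin_cases i <;> simp [Matrix.cons_val, Circle.coe_inv, Circle.coe_mul, h2]
  -- Haar on the torus is the image of `Haar_{U(1)}²`
  haveI : SecondCountableTopology (specialDiagonalTorus (Fin 3)) :=
    secondCountableTopology_specialDiagonalTorus
  have hmap := map_eq_haarProbability_of_mul_of_surjective
    (Measure.pi fun _ : Fin 2 => haarProbability Circle) hch_cont.measurable hch_mul hch_surj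
  have hKc : Continuous fun t : specialDiagonalTorus (Fin 3) =>
      K (((t : Matrix.specialUnitaryGroup (Fin 3) ℂ)) : Matrix (Fin 3) (Fin 3) ℂ) :=
    hK.comp (continuous_subtype_val.comp continuous_subtype_val)
  rw [← hmap, integral_map hch_cont.measurable.aemeasurable hKc.aestronglyMeasurable]
  -- Haar on `U(1)²` in angles
  have hKch : Continuous fun z : Fin 2 → Circle =>
      K ((((ch z : specialDiagonalTorus (Fin 3)) : Matrix.specialUnitaryGroup (Fin 3) ℂ)) :
        Matrix (Fin 3) (Fin 3) ℂ) := hKc.comp hch_cont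
  rw [integral_pi_haarProbability_circle _ hKch.aestronglyMeasurable]
  simp only [hch_coe, Fintype.card_fin, smul_eq_mul, Circle.coe_inv, Circle.coe_mul, Circle.coe_exp]
  -- the cube integral as an iterated integral
  have hcont : Continuous fun p : ℝ × ℝ =>
      K (Matrix.diagonal ![Complex.exp ((p.1 : ℂ) * Complex.I), Complex.exp ((p.2 : ℂ) * Complex.I),
        Complex.exp (((-(p.1 + p.2) : ℝ) : ℂ) * Complex.I)]) := by
    refine hK.comp (Continuous.matrix_diagonal (continuous_pi fun i => ?_))
    fin_cases i
    · simpa using (Complex.continuous_ofReal.comp continuous_fst).mul continuous_const |>.cexp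
    · simpa using (Complex.continuous_ofReal.comp continuous_snd).mul continuous_const |>.cexp
    · simpa using ((Complex.continuous_ofReal.comp (continuous_fst.add continuous_snd).neg).mul
        continuous_const).cexp
  simp_rw [cexp_mul_cexp_inv]
  have hbox := integral2_eq_setIntegral_pi (g := fun θ₁ θ₂ =>
    K (Matrix.diagonal ![Complex.exp ((θ₁ : ℂ) * Complex.I), Complex.exp ((θ₂ : ℂ) * Complex.I),
      Complex.exp (((-(θ₁ + θ₂) : ℝ) : ℂ) * Complex.I)]))
    (by linarith [Real.pi_pos] : -π ≤ π) hcont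
  rw [← hbox, inv_pow, one_div]

/-- The eigen-angle torus matrix is `2π`-periodic in `θ₁`. -/
theorem su3Diag_periodic_left (θ₁ θ₂ : ℝ) :
    (Matrix.diagonal ![Complex.exp (((θ₁ + 2 * π : ℝ) : ℂ) * Complex.I), Complex.exp ((θ₂ : ℂ) * Complex.I),
        Complex.exp (((-((θ₁ + 2 * π) + θ₂) : ℝ) : ℂ) * Complex.I)] : Matrix (Fin 3) (Fin 3) ℂ)
      = Matrix.diagonal ![Complex.exp ((θ₁ : ℂ) * Complex.I), Complex.exp ((θ₂ : ℂ) * Complex.I),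
        Complex.exp (((-(θ₁ + θ₂) : ℝ) : ℂ) * Complex.I)] := by
  have h1 : Complex.exp (((θ₁ + 2 * π : ℝ) : ℂ) * Complex.I) = Complex.exp ((θ₁ : ℂ) * Complex.I) := by
    push_cast
    rw [add_mul, Complex.exp_add, Complex.exp_two_pi_mul_I, mul_one]
  have h3 : Complex.exp (((-((θ₁ + 2 * π) + θ₂) : ℝ) : ℂ) * Complex.I)
      = Complex.exp (((-(θ₁ + θ₂) : ℝ) : ℂ) * Complex.I) := by
    have e : ((-((θ₁ + 2 * π) + θ₂) : ℝ) : ℂ) * Complex.I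
        = ((-(θ₁ + θ₂) : ℝ) : ℂ) * Complex.I + (-1 : ℤ) * (2 * π * Complex.I) := by push_cast; ring
    rw [e, Complex.exp_add, Complex.exp_int_mul_two_pi_mul_I, mul_one]
  rw [h1, h3]

/-- The eigen-angle torus matrix is `2π`-periodic in `θ₂`. -/
theorem su3Diag_periodic_right (θ₁ θ₂ : ℝ) :
    (Matrix.diagonal ![Complex.exp ((θ₁ : ℂ) * Complex.I), Complex.exp (((θ₂ + 2 * π : ℝ) : ℂ) * Complex.I),
        Complex.exp (((-(θ₁ + (θ₂ + 2 * π)) : ℝ) : ℂ) * Complex.I)] : Matrix (Fin 3) (Fin 3) ℂ)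
      = Matrix.diagonal ![Complex.exp ((θ₁ : ℂ) * Complex.I), Complex.exp ((θ₂ : ℂ) * Complex.I),
        Complex.exp (((-(θ₁ + θ₂) : ℝ) : ℂ) * Complex.I)] := by
  have h2 : Complex.exp (((θ₂ + 2 * π : ℝ) : ℂ) * Complex.I) = Complex.exp ((θ₂ : ℂ) * Complex.I) := by
    push_cast
    rw [add_mul, Complex.exp_add, Complex.exp_two_pi_mul_I, mul_one]
  have h3 : Complex.exp (((-(θ₁ + (θ₂ + 2 * π)) : ℝ) : ℂ) * Complex.I)
      = Complex.exp (((-(θ₁ + θ₂) : ℝ) : ℂ) * Complex.I) := by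
    have e : ((-(θ₁ + (θ₂ + 2 * π)) : ℝ) : ℂ) * Complex.I
        = ((-(θ₁ + θ₂) : ℝ) : ℂ) * Complex.I + (-1 : ℤ) * (2 * π * Complex.I) := by push_cast; ring
    rw [e, Complex.exp_add, Complex.exp_int_mul_two_pi_mul_I, mul_one]
  rw [h2, h3]

end Summit.Ventures.LatticeQCDFlow.Scoring
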